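import Literature.AlgebraicGeometry.Motives.FiniteFlatCoverReductionMultisetUnramified
import HarnessLib

/-!
# The fibre of a model morphism over the generic point of an integral point is the fibre of its generic fibre over the point
# ([Hartshorne1977] II.3 Thm. 3.3; [GortzWedhorn2020] Section (4.7); [StacksProject] 02G3, 00U3)

Topic `Literature/AlgebraicGeometry/Motives`, namespace `Literature.AlgebraicGeometry.Motives.IntegralModel` (D1 currency).  THEOREMS only (no def,
no instance, no notation, no named fact, no `sorry`).  Cell `hodgecm-mathlib` (D-0151), FLOOR 0, programme F0P5a, crux item stmt-HodgeConjecture-24832 —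
the (S-γ2) BRIDGE announced 2026-08-31T02:41Z: it moves the scheme-theoretic hypothesis of ★ p803860 (`Motives/FiniteFlatCoverReductionMultisetUnramified`:
«the fibre of `π.left` over the geometric generic point `Spec Ω → Spec R →(xt) 𝒮` is unramified») to where it arrives in practice — on the GENERIC FIBRES:
«`p : T ⟶ X` is unramified (étale) over `x ∈ X(Ω)`».

DATA: proper models `𝒮`, `𝒯` of `X`, `T` over `𝓞ᵥ`, a model morphism `π : 𝒯.total ⟶ 𝒮.total` with generic fibre `p` (`hπp :
(genericFibre).map π ≫ e_𝒮 = e_𝒯 ≫ p`), `x ∈ X(Ω)`, `xt : Spec R → 𝒮` its integral extension (`hxt`).  With `pr₁ : 𝒳_K = 𝒳 ×_{𝓞ᵥ} K → 𝒳`: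

* `isPullback_genericFibre_map_left` — **the square `𝒯_K → 𝒯`, `𝒮_K → 𝒮` with `(genericFibre).map π` and `π` is CARTESIAN** (pasting of the two
  base-change squares along `Spec K → Spec 𝓞ᵥ`);
* `isPullback_fibre_genericPoint` — hence the (chosen) fibre `pullback p.left x.left` of the generic fibre over `x` IS a fibre of `π.left` over the
  generic point `Spec Ω → Spec R →(xt) 𝒮` of `xt` (transport along `e_𝒮`, `e_𝒯`, then pasting);
* **`morphismProperty_snd_genericPoint_iff`** — for every iso-invariant property `P` of morphisms of schemes (`FormallyUnramified`, `Etale`, `IsFinite`, …):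
  `P (pullback.snd π.left (Spec Ω → Spec R → 𝒮)) ↔ P (pullback.snd p.left x.left)`;
* the (S-γ2) counts of ★ p803860 restated under `[FormallyUnramified (pullback.snd p.left x.left)]`:
  `isReduced_tensor_sections_of_formallyUnramified_genericFibre`, `card_fibre_eq_finrank_of_formallyUnramified_genericFibre`,
  `ncard_fibre_geomReductionMap_eq_finrank_corner_of_formallyUnramified_genericFibre`, `…_length_corner_…`.

HC_CM is proved only modulo the 7 printed citations until rung 0 closes; this file is a generic leaf and changes no count.

## References
* [Hartshorne1977] R. Hartshorne, *Algebraic Geometry*, II.3 Thm. 3.3 (fibre products; universal property and pasting).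
* [GortzWedhorn2020] U. Görtz, T. Wedhorn, *Algebraic Geometry I*, 2nd ed., Section (4.7) (fibres and base change, transitivity of fibre products).
* [StacksProject] The Stacks Project, Tags 02G3 (unramified morphisms, base change), 00U3 (étale algebras over fields).
-/

set_option autoImplicit false

noncomputable section

open CategoryTheory CategoryTheory.Limits AlgebraicGeometry IsDedekindDomain IsDedekindDomain.HeightOneSpectrum
open scoped NumberField TensorProduct
open Literature.NumberTheory.EllipticCurves (genericFibre specGenericPoint)
open Literature.NumberTheory.GaloisRepresentations (closureValuationSubring)
open Literature.NumberTheory.DiophantineGeometry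

namespace Literature.AlgebraicGeometry.Motives

namespace IntegralModel

variable {K : Type} [Field K] [NumberField K] {v : HeightOneSpectrum (𝓞 K)} {X T : SchemeOver K}

set_option backward.isDefEq.respectTransparency false in
/-- The transpose of `u : (Over.map g).obj U ⟶ 𝒳` along `Over.mapPullbackAdj g` has first component `u` on underlying schemes.
[cite: Hartshorne1977, II.3 Thm. 3.3 (fibre product, universal property)] -/
private theorem mapPullbackAdj_homEquiv_left_comp_fst₀ {S S' : Scheme.{0}} (g : S' ⟶ S) (U : Over S') (𝒳 : Over S)
    (u : (Over.map g).obj U ⟶ 𝒳) :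
    ((Over.mapPullbackAdj g).homEquiv U 𝒳 u).left ≫ pullback.fst 𝒳.hom g = u.left := by
  simp [Over.mapPullbackAdj]

set_option backward.isDefEq.respectTransparency false in
/-- The `Ω`-point of the model underlying `x ∈ X(Ω)`: `(e⁻¹ x).left = (x ≫ e_𝒳⁻¹).left ≫ pr₁` (local copy of ★ `IntegralModel.modelPointsEquiv_symm_left`
of `IntegralModelReductionMapClopen` (p796715), restated here to keep this leaf's imports light).
[cite: Hartshorne1977, II.3 Thm. 3.3 (fibre product, universal property)] -/
private theorem modelPointsEquiv_symm_left_aux (𝒳 : IntegralModel (valuationSubringAtPrime K v) K X)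
    (Q : AlgPoints X (AlgebraicClosure (v.adicCompletion K))) :
    (𝒳.modelPointsEquiv.symm Q).left =
      (Q ≫ 𝒳.genericIso'.inv).left ≫ pullback.fst 𝒳.total.hom (specGenericPoint (valuationSubringAtPrime K v) K) := by
  set P := 𝒳.modelPointsEquiv.symm Q with hP
  have hQ : 𝒳.modelPointsEquiv P = Q := 𝒳.modelPointsEquiv.apply_symm_apply Q
  rw [modelPointsEquiv_apply] at hQ
  have hQ' : Q ≫ 𝒳.genericIso'.inv =
      (Over.mapPullbackAdj (specGenericPoint (valuationSubringAtPrime K v) K)).homEquiv _ 𝒳.total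
        ((specFractionFieldIso v).inv ≫ P) := by
    rw [← hQ, Category.assoc, Iso.hom_inv_id, Category.comp_id]
  rw [hQ', mapPullbackAdj_homEquiv_left_comp_fst₀, Over.comp_left]
  change P.left = (Iso.refl _).inv ≫ P.left
  rw [Iso.refl_inv, Category.id_comp]

set_option backward.isDefEq.respectTransparency false in
/-- **The square `𝒯_K ⟶ 𝒯`, `𝒮_K ⟶ 𝒮` is cartesian**: for a model morphism `π : 𝒯 ⟶ 𝒮` over `𝓞ᵥ`, the generic fibre `𝒯_K = 𝒯 ×_{𝓞ᵥ} K` is the base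
change of `𝒯` along `pr₁ : 𝒮_K → 𝒮`, with comparison map `((genericFibre).map π).left` (pasting: `𝒯 ×_{𝓞ᵥ} K = 𝒯 ×_𝒮 (𝒮 ×_{𝓞ᵥ} K)`).
[cite: Hartshorne1977, II.3 Thm. 3.3 (fibre product, universal property)] [cite: GortzWedhorn2020, Section (4.7)] -/
theorem isPullback_genericFibre_map_left (𝒮 : IntegralModel (valuationSubringAtPrime K v) K X)
    (𝒯 : IntegralModel (valuationSubringAtPrime K v) K T) (π : 𝒯.total ⟶ 𝒮.total) :
    IsPullback ((genericFibre (valuationSubringAtPrime K v) K).map π).left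
      (pullback.fst 𝒯.total.hom (specGenericPoint (valuationSubringAtPrime K v) K))
      (pullback.fst 𝒮.total.hom (specGenericPoint (valuationSubringAtPrime K v) K)) π.left := by
  have hsnd : ((genericFibre (valuationSubringAtPrime K v) K).map π).left ≫
      pullback.snd 𝒮.total.hom (specGenericPoint (valuationSubringAtPrime K v) K) =
        pullback.snd 𝒯.total.hom (specGenericPoint (valuationSubringAtPrime K v) K) :=
    pullback.lift_snd _ _ _
  have hfst : ((genericFibre (valuationSubringAtPrime K v) K).map π).left ≫
      pullback.fst 𝒮.total.hom (specGenericPoint (valuationSubringAtPrime K v) K) =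
        pullback.fst 𝒯.total.hom (specGenericPoint (valuationSubringAtPrime K v) K) ≫ π.left :=
    pullback.lift_fst _ _ _
  refine IsPullback.of_right ?_ hfst (IsPullback.of_hasPullback 𝒮.total.hom (specGenericPoint (valuationSubringAtPrime K v) K)).flip
  rw [hsnd, Over.w π]
  exact (IsPullback.of_hasPullback 𝒯.total.hom (specGenericPoint (valuationSubringAtPrime K v) K)).flip

set_option backward.isDefEq.respectTransparency false in
/-- From `hπp`: `p ≫ e_𝒮⁻¹ = e_𝒯⁻¹ ≫ (genericFibre).map π` on underlying schemes. [cite: Hartshorne1977, II.3 Thm. 3.3 (fibre product, universal property)] -/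
theorem left_comp_genericIso'_inv_left (𝒮 : IntegralModel (valuationSubringAtPrime K v) K X)
    (𝒯 : IntegralModel (valuationSubringAtPrime K v) K T) (π : 𝒯.total ⟶ 𝒮.total) (p : T ⟶ X)
    (hπp : (genericFibre (valuationSubringAtPrime K v) K).map π ≫ 𝒮.genericIso'.hom = 𝒯.genericIso'.hom ≫ p) :
    p.left ≫ 𝒮.genericIso'.inv.left = 𝒯.genericIso'.inv.left ≫ ((genericFibre (valuationSubringAtPrime K v) K).map π).left := by
  have h : p ≫ 𝒮.genericIso'.inv = 𝒯.genericIso'.inv ≫ (genericFibre (valuationSubringAtPrime K v) K).map π := by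
    rw [Iso.eq_inv_comp, ← Category.assoc, ← hπp, Category.assoc, Iso.hom_inv_id, Category.comp_id]
  simpa only [Over.comp_left] using congrArg Over.Hom.left h

set_option backward.isDefEq.respectTransparency false in
/-- **The fibre of `p` over `x` is a fibre of `π.left` over the generic point of `xt`**: the chosen pullback `pullback p.left x.left` (projections
`fst ≫ e_𝒯⁻¹.left ≫ pr₁` and `snd`) is cartesian over `π.left` and `Spec Ω → Spec R →(xt) 𝒮` (★ `isPullback_genericFibre_map_left` pasted with the
fibre square transported along `e_𝒮`, `e_𝒯`; the bottom edge is `(e⁻¹ x).left = (x ≫ e_𝒮⁻¹).left ≫ pr₁` = the generic point of `xt`, by `hxt`).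
[cite: Hartshorne1977, II.3 Thm. 3.3 (fibre product, universal property)] [cite: GortzWedhorn2020, Section (4.7)] -/
theorem isPullback_fibre_genericPoint (𝒮 : IntegralModel (valuationSubringAtPrime K v) K X)
    (𝒯 : IntegralModel (valuationSubringAtPrime K v) K T) [IsProper 𝒮.total.hom] (π : 𝒯.total ⟶ 𝒮.total) (p : T ⟶ X)
    (hπp : (genericFibre (valuationSubringAtPrime K v) K).map π ≫ 𝒮.genericIso'.hom = 𝒯.genericIso'.hom ≫ p)
    (x : AlgPoints X (AlgebraicClosure (v.adicCompletion K)))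
    (xt : specValuationSubring (closureValuationSubring (v.adicCompletion K)) (toClosureValuationSubring v) ⟶ 𝒮.total)
    (hxt : extendPoint (closureValuationSubring (v.adicCompletion K)) (toClosureValuationSubring v) 𝒮.total (𝒮.modelPointsEquiv.symm x) = xt) :
    IsPullback
      (pullback.fst p.left x.left ≫ 𝒯.genericIso'.inv.left ≫ pullback.fst 𝒯.total.hom (specGenericPoint (valuationSubringAtPrime K v) K))
      (pullback.snd p.left x.left) π.left
      (Spec.map (CommRingCat.ofHom (algebraMap (closureValuationSubring (v.adicCompletion K)) (AlgebraicClosure (v.adicCompletion K)))) ≫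
        xt.left) := by
  -- the bottom edge: the generic point of `xt` is `(x ≫ e_𝒮⁻¹).left ≫ pr₁`
  have hbot : Spec.map (CommRingCat.ofHom (algebraMap (closureValuationSubring (v.adicCompletion K))
        (AlgebraicClosure (v.adicCompletion K)))) ≫ xt.left =
      (x.left ≫ 𝒮.genericIso'.inv.left) ≫ pullback.fst 𝒮.total.hom (specGenericPoint (valuationSubringAtPrime K v) K) := by
    have h1 : restrictPoint (closureValuationSubring (v.adicCompletion K)) (toClosureValuationSubring v) 𝒮.total xt =
        𝒮.modelPointsEquiv.symm x := by rw [← hxt, restrictPoint_extendPoint]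
    rw [← Over.comp_left, ← modelPointsEquiv_symm_left_aux, ← h1, restrictPoint_left]
  rw [hbot]
  -- transport the fibre square of `p` over `x` along `e_𝒯`, `e_𝒮`, then paste with the cartesian square `𝒯_K → 𝒯` over `𝒮_K → 𝒮`
  have sq : IsPullback (pullback.fst p.left x.left ≫ 𝒯.genericIso'.inv.left) (pullback.snd p.left x.left)
      ((genericFibre (valuationSubringAtPrime K v) K).map π).left (x.left ≫ 𝒮.genericIso'.inv.left) :=
    (IsPullback.of_hasPullback p.left x.left).of_iso (Iso.refl _)
      ((Over.forget _).mapIso 𝒯.genericIso'.symm) (Iso.refl _) ((Over.forget _).mapIso 𝒮.genericIso'.symm)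
      (by simp) (by simp) (by simpa using left_comp_genericIso'_inv_left 𝒮 𝒯 π p hπp) (by simp)
  simpa only [Category.assoc] using sq.paste_horiz (isPullback_genericFibre_map_left 𝒮 𝒯 π).flip

set_option backward.isDefEq.respectTransparency false in
/-- **Iso-invariant properties of the fibre over the generic point of `xt` are those of the fibre of `p` over `x`**: for `P` respecting isomorphisms
(`FormallyUnramified`, `Etale`, `IsFinite`, …), `P (pullback.snd π.left (Spec Ω → Spec R →(xt) 𝒮)) ↔ P (pullback.snd p.left x.left)`.
[cite: Hartshorne1977, II.3 Thm. 3.3 (fibre product, universal property)] [cite: StacksProject, Tag 02G3] -/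
theorem morphismProperty_snd_genericPoint_iff (P : MorphismProperty Scheme.{0}) [P.RespectsIso]
    (𝒮 : IntegralModel (valuationSubringAtPrime K v) K X)
    (𝒯 : IntegralModel (valuationSubringAtPrime K v) K T) [IsProper 𝒮.total.hom] (π : 𝒯.total ⟶ 𝒮.total) (p : T ⟶ X)
    (hπp : (genericFibre (valuationSubringAtPrime K v) K).map π ≫ 𝒮.genericIso'.hom = 𝒯.genericIso'.hom ≫ p)
    (x : AlgPoints X (AlgebraicClosure (v.adicCompletion K)))
    (xt : specValuationSubring (closureValuationSubring (v.adicCompletion K)) (toClosureValuationSubring v) ⟶ 𝒮.total)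
    (hxt : extendPoint (closureValuationSubring (v.adicCompletion K)) (toClosureValuationSubring v) 𝒮.total (𝒮.modelPointsEquiv.symm x) = xt) :
    P (pullback.snd π.left (Spec.map (CommRingCat.ofHom (algebraMap (closureValuationSubring (v.adicCompletion K))
        (AlgebraicClosure (v.adicCompletion K)))) ≫ xt.left)) ↔ P (pullback.snd p.left x.left) := by
  have h := isPullback_fibre_genericPoint 𝒮 𝒯 π p hπp x xt hxt
  rw [← h.isoPullback_inv_snd, P.cancel_left_of_respectsIso]


/-! ### The (S-γ2) counts with the hypothesis on the generic fibre: `p` unramified over `x` -/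

/-- **`p` unramified over `x` ⇒ `hred`**: if the fibre of the generic fibre `p : T ⟶ X` over `x ∈ X(Ω)` is formally unramified (e.g. `p` étale), the
generic fibre algebra `Ω ⊗_R Γ(pullback π.left xt.left, ⊤)` over the integral extension `xt` of `x` is reduced (★ p803860 + `morphismProperty_snd_genericPoint_iff`).
[cite: StacksProject, Tag 00U3] [cite: StacksProject, Tag 02G3] -/
theorem isReduced_tensor_sections_of_formallyUnramified_genericFibre (𝒮 : IntegralModel (valuationSubringAtPrime K v) K X)
    (𝒯 : IntegralModel (valuationSubringAtPrime K v) K T) [IsProper 𝒮.total.hom]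
    (π : 𝒯.total ⟶ 𝒮.total) (p : T ⟶ X)
    (hπp : (genericFibre (valuationSubringAtPrime K v) K).map π ≫ 𝒮.genericIso'.hom = 𝒯.genericIso'.hom ≫ p) [IsFinite π.left]
    (x : AlgPoints X (AlgebraicClosure (v.adicCompletion K)))
    (xt : specValuationSubring (closureValuationSubring (v.adicCompletion K)) (toClosureValuationSubring v) ⟶ 𝒮.total)
    (hxt : extendPoint (closureValuationSubring (v.adicCompletion K)) (toClosureValuationSubring v) 𝒮.total (𝒮.modelPointsEquiv.symm x) = xt)
    [FormallyUnramified (pullback.snd p.left x.left)]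
    [Algebra ↥(closureValuationSubring (v.adicCompletion K)) ((pullback π.left xt.left).presheaf.obj (Opposite.op ⊤))]
    (halg : algebraMap ↥(closureValuationSubring (v.adicCompletion K)) ((pullback π.left xt.left).presheaf.obj (Opposite.op ⊤)) = ((Scheme.ΓSpecIso (CommRingCat.of ↥(closureValuationSubring (v.adicCompletion K)))).inv ≫ (pullback.snd π.left xt.left).appTop).hom) :
    IsReduced (AlgebraicClosure (v.adicCompletion K) ⊗[↥(closureValuationSubring (v.adicCompletion K))] ((pullback π.left xt.left).presheaf.obj (Opposite.op ⊤))) := by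
  haveI : FormallyUnramified (pullback.snd π.left (Spec.map (CommRingCat.ofHom (algebraMap (closureValuationSubring (v.adicCompletion K))
      (AlgebraicClosure (v.adicCompletion K)))) ≫ xt.left)) :=
    (morphismProperty_snd_genericPoint_iff @FormallyUnramified 𝒮 𝒯 π p hπp x xt hxt).2 ‹_›
  exact isReduced_tensor_sections_of_formallyUnramified_fibre 𝒮 𝒯 π xt halg

/-- **`#{y ∈ T(Ω) : p y = x} = rank_R Γ(pullback π.left xt.left, ⊤)` for `π.left` finite flat and `p` unramified over `x`.**
[cite: Liu2002, §10.1.3] [cite: StacksProject, Tag 00U3] -/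
theorem card_fibre_eq_finrank_of_formallyUnramified_genericFibre (𝒮 : IntegralModel (valuationSubringAtPrime K v) K X)
    (𝒯 : IntegralModel (valuationSubringAtPrime K v) K T) [IsProper 𝒮.total.hom] [IsProper 𝒯.total.hom]
    (π : 𝒯.total ⟶ 𝒮.total) (p : T ⟶ X)
    (hπp : (genericFibre (valuationSubringAtPrime K v) K).map π ≫ 𝒮.genericIso'.hom = 𝒯.genericIso'.hom ≫ p) [IsFinite π.left] [Flat π.left]
    (x : AlgPoints X (AlgebraicClosure (v.adicCompletion K)))
    (xt : specValuationSubring (closureValuationSubring (v.adicCompletion K)) (toClosureValuationSubring v) ⟶ 𝒮.total)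
    (hxt : extendPoint (closureValuationSubring (v.adicCompletion K)) (toClosureValuationSubring v) 𝒮.total (𝒮.modelPointsEquiv.symm x) = xt)
    [FormallyUnramified (pullback.snd p.left x.left)]
    [Algebra ↥(closureValuationSubring (v.adicCompletion K)) ((pullback π.left xt.left).presheaf.obj (Opposite.op ⊤))]
    (halg : algebraMap ↥(closureValuationSubring (v.adicCompletion K)) ((pullback π.left xt.left).presheaf.obj (Opposite.op ⊤)) = ((Scheme.ΓSpecIso (CommRingCat.of ↥(closureValuationSubring (v.adicCompletion K)))).inv ≫ (pullback.snd π.left xt.left).appTop).hom) :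
    Nat.card {y : AlgPoints T (AlgebraicClosure (v.adicCompletion K)) // AlgPoints.map p y = x} = Module.finrank ↥(closureValuationSubring (v.adicCompletion K)) ((pullback π.left xt.left).presheaf.obj (Opposite.op ⊤)) := by
  haveI : FormallyUnramified (pullback.snd π.left (Spec.map (CommRingCat.ofHom (algebraMap (closureValuationSubring (v.adicCompletion K))
      (AlgebraicClosure (v.adicCompletion K)))) ≫ xt.left)) :=
    (morphismProperty_snd_genericPoint_iff @FormallyUnramified 𝒮 𝒯 π p hπp x xt hxt).2 ‹_›
  exact card_fibre_eq_finrank_of_formallyUnramified_fibre 𝒮 𝒯 π p hπp x xt hxt halg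

/-- **MAIN, hypothesis on the generic fibre (rank form)**: for `π.left` finite flat and `p` unramified over `x`, the number of points of the generic
geometric fibre over `x` reducing to `reductionPoint yκ` is the rank of the corner of the fibre algebra at `yκ`.
[cite: SerreTate1968, §1] [cite: Liu2002, §10.1.3] [cite: StacksProject, Tag 04GG] -/
theorem ncard_fibre_geomReductionMap_eq_finrank_corner_of_formallyUnramified_genericFibre (𝒮 : IntegralModel (valuationSubringAtPrime K v) K X)
    (𝒯 : IntegralModel (valuationSubringAtPrime K v) K T)
    [IsProper 𝒮.total.hom] [IsProper 𝒯.total.hom]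
    (π : 𝒯.total ⟶ 𝒮.total) (p : T ⟶ X)
    (hπp : (genericFibre (valuationSubringAtPrime K v) K).map π ≫ 𝒮.genericIso'.hom = 𝒯.genericIso'.hom ≫ p) [IsFinite π.left] [Flat π.left]
    (x : AlgPoints X (AlgebraicClosure (v.adicCompletion K)))
    (xt : specValuationSubring (closureValuationSubring (v.adicCompletion K)) (toClosureValuationSubring v) ⟶ 𝒮.total)
    (hxt : extendPoint (closureValuationSubring (v.adicCompletion K)) (toClosureValuationSubring v) 𝒮.total (𝒮.modelPointsEquiv.symm x) = xt)
    [FormallyUnramified (pullback.snd p.left x.left)]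
    [Algebra ↥(closureValuationSubring (v.adicCompletion K)) ((pullback π.left xt.left).presheaf.obj (Opposite.op ⊤))]
    (halg : algebraMap ↥(closureValuationSubring (v.adicCompletion K)) ((pullback π.left xt.left).presheaf.obj (Opposite.op ⊤)) = ((Scheme.ΓSpecIso (CommRingCat.of ↥(closureValuationSubring (v.adicCompletion K)))).inv ≫ (pullback.snd π.left xt.left).appTop).hom)
    [Fintype (MaximalSpectrum (((pullback π.left xt.left).presheaf.obj (Opposite.op ⊤)) ⧸ (IsLocalRing.maximalIdeal ↥(closureValuationSubring (v.adicCompletion K))).map (algebraMap ↥(closureValuationSubring (v.adicCompletion K)) ((pullback π.left xt.left).presheaf.obj (Opposite.op ⊤)))))]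
    (e : (MaximalSpectrum (((pullback π.left xt.left).presheaf.obj (Opposite.op ⊤)) ⧸ (IsLocalRing.maximalIdeal ↥(closureValuationSubring (v.adicCompletion K))).map (algebraMap ↥(closureValuationSubring (v.adicCompletion K)) ((pullback π.left xt.left).presheaf.obj (Opposite.op ⊤))))) → ((pullback π.left xt.left).presheaf.obj (Opposite.op ⊤))) (he : CompleteOrthogonalIdempotents e)
    (hsep1 : ∀ I, 1 - e I ∈ I.asIdeal.comap (Ideal.Quotient.mk _)) (hsep0 : ∀ I I', I ≠ I' → e I ∈ I'.asIdeal.comap (Ideal.Quotient.mk _))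
    (yκ : residueFieldPoints 𝒯.total)
    (hyκ : yκ ≫ π = specRingHomι (closureValuationSubring (v.adicCompletion K)) (toClosureValuationSubring v) (IsLocalRing.residue (closureValuationSubring (v.adicCompletion K))) ≫ xt)
    (I : (MaximalSpectrum (((pullback π.left xt.left).presheaf.obj (Opposite.op ⊤)) ⧸ (IsLocalRing.maximalIdeal ↥(closureValuationSubring (v.adicCompletion K))).map (algebraMap ↥(closureValuationSubring (v.adicCompletion K)) ((pullback π.left xt.left).presheaf.obj (Opposite.op ⊤)))))) (hI : RingHom.ker ((pullback.lift yκ.left (Spec.map (CommRingCat.ofHom (IsLocalRing.residue (closureValuationSubring (v.adicCompletion K))))) (left_comp_left_eq_of_comp_eq 𝒮 𝒯 π xt yκ hyκ)).appTop ≫ (Scheme.ΓSpecIso (CommRingCat.of (IsLocalRing.ResidueField ↥(closureValuationSubring (v.adicCompletion K))))).hom).hom = I.asIdeal.comap (Ideal.Quotient.mk _)) :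
    Set.ncard {y : AlgPoints T (AlgebraicClosure (v.adicCompletion K)) | AlgPoints.map p y = x ∧ 𝒯.geomReductionMap y = 𝒯.reductionPoint yκ} =
      Module.finrank ↥(closureValuationSubring (v.adicCompletion K)) (((pullback π.left xt.left).presheaf.obj (Opposite.op ⊤)) ⧸ Ideal.span {1 - e I}) := by
  haveI : FormallyUnramified (pullback.snd π.left (Spec.map (CommRingCat.ofHom (algebraMap (closureValuationSubring (v.adicCompletion K))
      (AlgebraicClosure (v.adicCompletion K)))) ≫ xt.left)) :=
    (morphismProperty_snd_genericPoint_iff @FormallyUnramified 𝒮 𝒯 π p hπp x xt hxt).2 ‹_›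
  exact ncard_fibre_geomReductionMap_eq_finrank_corner_of_formallyUnramified_fibre 𝒮 𝒯 π p hπp x xt hxt halg e he hsep1 hsep0
    yκ hyκ I hI

/-- **MAIN, hypothesis on the generic fibre (length form)**: … `= length (B_I ⧸ 𝔪 B_I)`, the multiplicity of `reductionPoint yκ` in the special fibre.
[cite: SerreTate1968, §1] [cite: Liu2002, §10.1.3] [cite: StacksProject, Tag 02M0] -/
theorem ncard_fibre_geomReductionMap_eq_length_corner_of_formallyUnramified_genericFibre (𝒮 : IntegralModel (valuationSubringAtPrime K v) K X)
    (𝒯 : IntegralModel (valuationSubringAtPrime K v) K T)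
    [IsProper 𝒮.total.hom] [IsProper 𝒯.total.hom]
    (π : 𝒯.total ⟶ 𝒮.total) (p : T ⟶ X)
    (hπp : (genericFibre (valuationSubringAtPrime K v) K).map π ≫ 𝒮.genericIso'.hom = 𝒯.genericIso'.hom ≫ p) [IsFinite π.left] [Flat π.left]
    (x : AlgPoints X (AlgebraicClosure (v.adicCompletion K)))
    (xt : specValuationSubring (closureValuationSubring (v.adicCompletion K)) (toClosureValuationSubring v) ⟶ 𝒮.total)
    (hxt : extendPoint (closureValuationSubring (v.adicCompletion K)) (toClosureValuationSubring v) 𝒮.total (𝒮.modelPointsEquiv.symm x) = xt)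
    [FormallyUnramified (pullback.snd p.left x.left)]
    [Algebra ↥(closureValuationSubring (v.adicCompletion K)) ((pullback π.left xt.left).presheaf.obj (Opposite.op ⊤))]
    (halg : algebraMap ↥(closureValuationSubring (v.adicCompletion K)) ((pullback π.left xt.left).presheaf.obj (Opposite.op ⊤)) = ((Scheme.ΓSpecIso (CommRingCat.of ↥(closureValuationSubring (v.adicCompletion K)))).inv ≫ (pullback.snd π.left xt.left).appTop).hom)
    [Fintype (MaximalSpectrum (((pullback π.left xt.left).presheaf.obj (Opposite.op ⊤)) ⧸ (IsLocalRing.maximalIdeal ↥(closureValuationSubring (v.adicCompletion K))).map (algebraMap ↥(closureValuationSubring (v.adicCompletion K)) ((pullback π.left xt.left).presheaf.obj (Opposite.op ⊤)))))]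
    (e : (MaximalSpectrum (((pullback π.left xt.left).presheaf.obj (Opposite.op ⊤)) ⧸ (IsLocalRing.maximalIdeal ↥(closureValuationSubring (v.adicCompletion K))).map (algebraMap ↥(closureValuationSubring (v.adicCompletion K)) ((pullback π.left xt.left).presheaf.obj (Opposite.op ⊤))))) → ((pullback π.left xt.left).presheaf.obj (Opposite.op ⊤))) (he : CompleteOrthogonalIdempotents e)
    (hsep1 : ∀ I, 1 - e I ∈ I.asIdeal.comap (Ideal.Quotient.mk _)) (hsep0 : ∀ I I', I ≠ I' → e I ∈ I'.asIdeal.comap (Ideal.Quotient.mk _))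
    (hloc : ∀ I, IsLocalRing (((pullback π.left xt.left).presheaf.obj (Opposite.op ⊤)) ⧸ Ideal.span {1 - e I}))
    (yκ : residueFieldPoints 𝒯.total)
    (hyκ : yκ ≫ π = specRingHomι (closureValuationSubring (v.adicCompletion K)) (toClosureValuationSubring v) (IsLocalRing.residue (closureValuationSubring (v.adicCompletion K))) ≫ xt)
    (I : (MaximalSpectrum (((pullback π.left xt.left).presheaf.obj (Opposite.op ⊤)) ⧸ (IsLocalRing.maximalIdeal ↥(closureValuationSubring (v.adicCompletion K))).map (algebraMap ↥(closureValuationSubring (v.adicCompletion K)) ((pullback π.left xt.left).presheaf.obj (Opposite.op ⊤)))))) (hI : RingHom.ker ((pullback.lift yκ.left (Spec.map (CommRingCat.ofHom (IsLocalRing.residue (closureValuationSubring (v.adicCompletion K))))) (left_comp_left_eq_of_comp_eq 𝒮 𝒯 π xt yκ hyκ)).appTop ≫ (Scheme.ΓSpecIso (CommRingCat.of (IsLocalRing.ResidueField ↥(closureValuationSubring (v.adicCompletion K))))).hom).hom = I.asIdeal.comap (Ideal.Quotient.mk _)) :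
    (Set.ncard {y : AlgPoints T (AlgebraicClosure (v.adicCompletion K)) | AlgPoints.map p y = x ∧ 𝒯.geomReductionMap y = 𝒯.reductionPoint yκ} : ℕ∞) =
      Module.length (((pullback π.left xt.left).presheaf.obj (Opposite.op ⊤)) ⧸ Ideal.span {1 - e I})
        ((((pullback π.left xt.left).presheaf.obj (Opposite.op ⊤)) ⧸ Ideal.span {1 - e I}) ⧸ (IsLocalRing.maximalIdeal ↥(closureValuationSubring (v.adicCompletion K))).map (algebraMap ↥(closureValuationSubring (v.adicCompletion K)) (((pullback π.left xt.left).presheaf.obj (Opposite.op ⊤)) ⧸ Ideal.span {1 - e I}))) := by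
  haveI : FormallyUnramified (pullback.snd π.left (Spec.map (CommRingCat.ofHom (algebraMap (closureValuationSubring (v.adicCompletion K))
      (AlgebraicClosure (v.adicCompletion K)))) ≫ xt.left)) :=
    (morphismProperty_snd_genericPoint_iff @FormallyUnramified 𝒮 𝒯 π p hπp x xt hxt).2 ‹_›
  exact ncard_fibre_geomReductionMap_eq_length_corner_of_formallyUnramified_fibre 𝒮 𝒯 π p hπp x xt hxt halg e he hsep1 hsep0
    hloc yκ hyκ I hI

end IntegralModel

end Literature.AlgebraicGeometry.Motives

end
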